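import Summits.HodgeConjecture.HodgeConjecture.Theorems.HeckePrymWeilHodgeWeilOfLevelStructure
import HarnessLib

/-!
# The `ℚ(√-p)` Hodge–Weil rungs are EQUIVALENT to variational Hodge for flat WEIL classes (given Deligne's family)

Route `HeckePrymWeil` (sub-problem `HodgeConjecture`); lead seat c5 of crux `WeilTwelvefoldsSqrtMinus7`
(stmt-HodgeConjecture-1261), line `isotypic-unimodular-saturation`, reshape r4 ("Weil transport").

The rung predicate `HWA(p, k)`: on every complex abelian `2k`-fold `(A, φ)` with `φ ≫ φ = -p` every
rational `(k,k)`-class of the typed Weil plane `Eig((𝟙+φ)^*, (1+i√p)^{2k}) ⊔ Eig((𝟙+φ)^*, (1-i√p)^{2k})`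
is algebraic.  Reshape r3 (lead c4, `hodgeWeil_of_transport_of_sections`) derived `HWA(p, k)` from
Deligne's family package and TRANSPORT of EVERY rational `(k,k)` global class along EVERY smooth
projective family of `√-p`-abelian `2k`-folds (`WeilVariationalHodge`, stmt-HodgeConjecture-14497, at
`M = k`).  The composition only ever feeds the transport the flat WEIL section of Deligne's family, and
that section lies in the Weil plane of EVERY fibre (transport of the Weil eigen-lines under the global
`√-p`, `transportFun_mem_eigenLines`, read in the charts of the abelian scheme,
`map_mem_weilClassesOf_of_mem_eigenLines`).  This file therefore

* WEAKENS the transport hypothesis to `WT(p, k)` = variational Hodge for global classes that are, at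
  every fibre, rational of type `(k,k)` AND carried by a chart `e' : A' ≅ 𝒳_s` (`A'` a `√-p`-abelian
  `2k`-fold) into the strong Weil plane `weilClassesOf A' φ' k p`
  (`hodgeWeil_of_weilTransport_of_globalAction`: `HWA(p,k) ⟸ deligne1982_weilFamily_globalAction + WT(p,k)`;
  the global action is the tree's theorem of the one named fact `deligne1982_weilFamily_levelStructure`);
* proves TIGHTNESS (`weilTransport_of_hodgeWeil`: `HWA(p,k) ⟹ WT(p,k)`, by the chart, iso-invariance and
  `mem_eigenspace_sup_of_mem_weilClassesOf` — no family structure is needed in this direction);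
* hence `hodgeWeil_iff_weilTransport_of_globalAction`: GIVEN Deligne's family, `HWA(p,k) ⟺ WT(p,k)`, and
  `WT(p,k) ⟸` transport of all `(k,k)` classes (`weilTransport_of_transport`) `⟸ WeilVariationalHodge`.

At `(p, k) = (7, 6)` (sequel file `HeckePrymWeilWeilTwelvefoldsSqrtMinus7OfWeilTransport`): the crux
`WeilTwelvefoldsSqrtMinus7` is, modulo the literature construction M3, EQUIVALENT to its line's C⁺, which
is implied by `WeilVariationalHodge` — the certificate that no reduction is left inside the line.
CONDITIONAL on the hypotheses spelled out; no `sorry`, no new definition.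
-/

noncomputable section

-- every declaration of this problem lives in `Summit.HodgeConjecture.HodgeConjecture.…` (summit = sub-problem)
set_option linter.dupNamespace false

open CategoryTheory AlgebraicGeometry Limits MonoidalCategory CartesianMonoidalCategory

namespace Summit.HodgeConjecture.HodgeConjecture.Theorems.HeckePrymWeilLine

open Literature.AlgebraicGeometry Literature.AlgebraicGeometry.Motives Literature.AlgebraicGeometry.HodgeTheory
open Literature.AlgebraicTopology.SingularHomology
open Summit.HodgeConjecture.HodgeConjecture.Theses.HeckePrymWeil

/-! ### The global Weil class of Deligne's family: fibrewise rational, Hodge, IN THE WEIL PLANE of a chart, algebraic at the tensor fibre -/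

/-- **The global Weil class of Deligne's abelian scheme with `K`-action.**  Granted
`deligne1982_weilFamily_globalAction`: for a prime `p ≡ 3 (4)`, `p ≥ 7`, `k ≥ 1`, a `√-p`-abelian
`2k`-fold `(X, Φ)` and a non-zero rational `(k,k)` class `c` of its strong Weil plane, there are a smooth
projective family `f : 𝒳 → S` over a smooth irreducible base, points `s₁, s₀`, `e : X ≅ 𝒳_{s₁}` and a
GLOBAL class `W ∈ H^{2k}(𝒳(ℂ); ℂ)` whose fibre restrictions are rational of type `(k,k)`, lie — through a
chart `e' : A' ≅ 𝒳_s` of a `√-p`-abelian `2k`-fold — in the strong Weil plane `weilClassesOf A' φ' k p`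
at EVERY fibre, restrict to `e^{-1 *} c` at `s₁`, and are ALGEBRAIC at `s₀` (the tensor-split fibre:
Deligne's Lemma 4.5 anchor `owf_anchorAlgebraic` across the isogeny pair).  Proof: the continuous
section `σ` of the package, globalised by the tree's W-engine (`stub_globalClassOfSection_of_leray
deligne1968_invariantClass_fromTotalSpace_holds`); rationality along the section
(`stub_rationalAlongSection`); the values of `σ` stay in the cohomological Weil planes of the fibre maps
of the global `√-p` (`transportFun_mem_eigenLines` from `s₁`, where `e^{-1 *} c` lies by
`map_inv_mem_eigenLines_of_mem_weilClassesOf`), which the charts carry into `weilClassesOf A' φ' k p`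
(`map_mem_weilClassesOf_of_mem_eigenLines`), whence the Hodge type by the balanced clause of the package.
[cite: Deligne1982HodgeCycles, proof of Thm. 4.8 (pp. 47–52) with Prop. 4.4, Lemma 4.5, Remark 4.10]
[cite: VoisinHodgeII2003, §3.1.2] -/
theorem weilFamily_globalWeilClass_of_globalAction (hGA : deligne1982_weilFamily_globalAction)
    {p : ℕ} (hp : p.Prime) (hp4 : p % 4 = 3) (hp7 : 7 ≤ p) {k : ℕ} (hk : 1 ≤ k)
    (X : AbelianVariety ℂ) (Φ : X ⟶ X) (hX : X.dim = 2 * k) (hΦ : Φ ≫ Φ = -((p : ℤ) • 𝟙 X))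
    (c : complexBetti X.X (2 * k)) (hc : c ∈ weilClassesOf X Φ k p) (hc0 : c ≠ 0)
    (hrat : IsRationalClass c) (hH : IsOfHodgeType (2 * k) X.X (2 * k) k k c) :
    ∃ (𝒳 S : SchemeOver ℂ) (f : 𝒳 ⟶ S) (s₁ s₀ : ComplexPoints S) (e : X.X ≅ fiberOver f s₁)
      (W : complexBetti 𝒳 (2 * k)),
      IsSmoothProjectiveFamily f (2 * k) ∧ IrreducibleSpace S.left ∧ AlgebraicGeometry.Smooth S.hom ∧
      (∀ s : ComplexPoints S, IsRationalClass (complexBetti.map (fiberι f s) (2 * k) W) ∧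
        IsOfHodgeType (2 * k) (fiberOver f s) (2 * k) k k (complexBetti.map (fiberι f s) (2 * k) W)) ∧
      (∀ s : ComplexPoints S, ∃ (A' : AbelianVariety ℂ) (φ' : A' ⟶ A') (e' : A'.X ≅ fiberOver f s),
        A'.dim = 2 * k ∧ φ' ≫ φ' = -((p : ℤ) • 𝟙 A') ∧
        complexBetti.map e'.hom (2 * k) (complexBetti.map (fiberι f s) (2 * k) W) ∈ weilClassesOf A' φ' k p) ∧
      complexBetti.map (fiberι f s₁) (2 * k) W = complexBetti.map e.inv (2 * k) c ∧
      complexBetti.map (fiberι f s₀) (2 * k) W ∈ algebraicClasses (fiberOver f s₀) k := by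
  obtain ⟨𝒳, S, f, g, s₁, s₀, e, σ, hfam, hemb, hirr, hsm, hSqp, hg, hfib, he, hσ, hpt, hσ₁, Y, Ψ,
    e₀, ⟨A₁, f₁, g₁, m, hA₁, hY, hΨ, hm, hfg, hf, hg₁⟩, he₀⟩ := hGA p hp hp4 hp7 k hk X Φ hX hΦ c hc hc0 hrat hH
  have hp0 : 0 < p := hp.pos
  -- the base: `S(ℂ)` is a path-connected manifold and `R^{2k} f_* ℂ` is a local system on it
  haveI := hsm
  haveI := hirr
  haveI : LocallyOfFiniteType S.hom := hSqp.locallyOfFiniteType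
  haveI : ConnectedSpace (ComplexPoints S) :=
    (Motives.ComplexPoints.connectedSpace_iff_holds S).2 inferInstance
  obtain ⟨d, hd⟩ := exists_smoothOfRelativeDimension_of_connectedSpace_complexPoints S
  haveI := hd
  haveI := pathConnectedSpace_complexPoints_of_smoothOfRelativeDimension S d
  have hU := isCohomologicallyLocallyTrivialOn_univ_of_isSmoothProjectiveFamily f d hfam hSqp
  -- the fibre maps of `g`
  have hgf' := fun t ↦ exists_fiberHom_comp_fiberι f g hg t
  choose gf hgf using hgf'
  -- the cohomological Weil plane of the fibre over `t`
  let WP : ∀ t : ComplexPoints S, Submodule ℂ (complexBetti (fiberOver f t) (2 * k)) :=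
    fun t ↦
      Submodule.span ℂ
        {x | ∃ w : Fin (2 * k) → complexBetti (fiberOver f t) 1,
          (∀ i, w i ∈ Module.End.eigenspace (complexBetti.map (gf t) 1).hom
            (Complex.I * (Real.sqrt p : ℂ))) ∧
          cupPowOne ℂ (ComplexPoints (fiberOver f t)) (2 * k) w = x} ⊔
      Submodule.span ℂ
        {x | ∃ w : Fin (2 * k) → complexBetti (fiberOver f t) 1,
          (∀ i, w i ∈ Module.End.eigenspace (complexBetti.map (gf t) 1).hom
            (-(Complex.I * (Real.sqrt p : ℂ)))) ∧
          cupPowOne ℂ (ComplexPoints (fiberOver f t)) (2 * k) w = x}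
  -- at `s₁`: `e^{-1 *} c` lies in the Weil plane of `(𝒳_{s₁}, g_{s₁})`
  have hΦ' : Φ ≫ Φ = -(p • 𝟙 X) := by rw [hΦ, natCast_zsmul]
  have he' : e.hom ≫ gf s₁ = Φ.hom.hom.hom ≫ e.hom :=
    hom_comp_fiberHom_eq_of_comp_fiberι f g (hgf s₁) e Φ.hom.hom.hom he
  have h₁ : complexBetti.map e.inv (2 * k) c ∈ WP s₁ :=
    map_inv_mem_eigenLines_of_mem_weilClassesOf e (gf s₁) hp0 hX hΦ' he' hc
  -- transport from `s₁`: every value of `σ` lies in the Weil plane of its fibre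
  have key : ∀ (s t : ComplexPoints S) (hst : (σ s).pt = t), (σ s).clsAt hst ∈ WP t := by
    intro s t hst
    obtain rfl : s = t := (hpt s).symm.trans hst
    let γ : Path (⟨s₁, Set.mem_univ s₁⟩ : (Set.univ : Set (ComplexPoints S))) ⟨s, Set.mem_univ s⟩ :=
      (PathConnectedSpace.somePath s₁ s).map (continuous_id.subtype_mk _)
    have htr := transportFun_clsAt_of_continuous f (2 * k) hU hσ hpt γ
    have h0 : (σ s₁).clsAt (hpt s₁) = complexBetti.map e.inv (2 * k) c := by
      rw [FiberClass.clsAt_eq_iff]; exact hσ₁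
    change transportFun f (2 * k) hU ⟦γ⟧ ((σ s₁).clsAt (hpt s₁)) = (σ s).clsAt (hpt s) at htr
    rw [← htr, h0]
    exact transportFun_mem_eigenLines f hU g hg gf hgf ⟦γ⟧ _ _ (2 * k) h₁
  -- the global class of the section (W-engine, discharged in the tree)
  obtain ⟨W, hWσ⟩ := stub_globalClassOfSection_of_leray deligne1968_invariantClass_fromTotalSpace_holds
    f (2 * k) (2 * k) hfam hemb hsm hSqp hirr σ hσ hpt
  have hWs : ∀ s : ComplexPoints S, complexBetti.map (fiberι f s) (2 * k) W = (σ s).clsAt (hpt s) := by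
    intro s
    symm
    rw [FiberClass.clsAt_eq_iff]
    exact hWσ s
  -- rationality along the section
  have hrat₁ : IsRationalClass (σ s₁).cls := by
    rw [hσ₁]; exact hrat.map _
  have hratσ : ∀ s, IsRationalClass (σ s).cls :=
    stub_rationalAlongSection f (2 * k) (2 * k) hfam hsm hSqp hirr σ hσ hpt s₁ hrat₁
  -- the charts: `W|_{𝒳_s}` read in `A'_s` lies in the strong Weil plane of `(A'_s, φ'_s)`
  have hchart : ∀ s : ComplexPoints S, ∃ (A' : AbelianVariety ℂ) (φ' : A' ⟶ A') (e' : A'.X ≅ fiberOver f s),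
      A'.dim = 2 * k ∧ φ' ≫ φ' = -((p : ℤ) • 𝟙 A') ∧
      complexBetti.map e'.hom (2 * k) (complexBetti.map (fiberι f s) (2 * k) W) ∈ weilClassesOf A' φ' k p ∧
      ∀ w ∈ weilClassesOf A' φ' k p, IsOfHodgeType (2 * k) A'.X (2 * k) k k w := by
    intro s
    obtain ⟨A', φ', e', hA', hφ', he'c, hbal⟩ := hfib s
    have he'' : e'.hom ≫ gf s = φ'.hom.hom.hom ≫ e'.hom :=
      hom_comp_fiberHom_eq_of_comp_fiberι f g (hgf _) e' φ'.hom.hom.hom he'c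
    refine ⟨A', φ', e', hA', hφ', ?_, hbal⟩
    rw [hWs s]
    exact map_mem_weilClassesOf_of_mem_eigenLines e' (gf _) he'' (key s s (hpt s))
  refine ⟨𝒳, S, f, s₁, s₀, e, W, hfam, hirr, hsm, fun s ↦ ⟨?_, ?_⟩, fun s ↦ ?_, ?_, ?_⟩
  · -- rational
    rw [hWs s]
    exact (ras_isRationalClass_clsAt_iff (σ s) (hpt s)).2 (hratσ s)
  · -- Hodge type `(k,k)`: read in the chart
    obtain ⟨A', φ', e', hA', hφ', hmem, hbal⟩ := hchart s
    have htyp := (hbal _ hmem).map_of_iso e'.symm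
    have hid : singularCohomology.map ℂ ℂ (Motives.AlgPoints.mapContinuous (L := ℂ) e'.symm.hom) (2 * k)
        (complexBetti.map e'.hom (2 * k) (complexBetti.map (fiberι f s) (2 * k) W)) =
          complexBetti.map (fiberι f s) (2 * k) W := by
      change complexBetti.map e'.inv (2 * k) (complexBetti.map e'.hom (2 * k) _) = _
      rw [← ModuleCat.comp_apply, ← complexBetti.map_comp, e'.inv_hom_id, complexBetti.map_id]
      rfl
    rw [hid] at htyp
    exact htyp
  · obtain ⟨A', φ', e', hA', hφ', hmem, -⟩ := hchart s
    exact ⟨A', φ', e', hA', hφ', hmem⟩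
  · -- at `s₁`
    rw [hWs s₁, FiberClass.clsAt_eq_iff]
    exact hσ₁
  · -- at `s₀`: the tensor-split fibre is algebraic
    have he₀' : e₀.hom ≫ gf s₀ = Ψ.hom.hom.hom ≫ e₀.hom :=
      hom_comp_fiberHom_eq_of_comp_fiberι f g (hgf s₀) e₀ Ψ.hom.hom.hom he₀
    have hx : complexBetti.map e₀.hom (2 * k) (complexBetti.map (fiberι f s₀) (2 * k) W) ∈
        weilClassesOf Y Ψ k p := by
      rw [hWs s₀]
      exact map_mem_weilClassesOf_of_mem_eigenLines e₀ (gf s₀) he₀' (key s₀ s₀ (hpt s₀))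
    exact owf_isoTransport _ Y e₀ k _
      (owf_anchorAlgebraic hp hp4 hp7 A₁ f₁ g₁ m hA₁ hY hΨ hm hfg hf hg₁ hx)

/-! ### `HWA(p, k)` from Deligne's family and WEIL transport only -/

/-- **`HWA(p, k)` from Deligne's abelian scheme with `K`-action and transport of WEIL classes only.**
For a prime `p ≡ 3 (4)`, `p ≥ 7`, and `k ≥ 1`: if `hGA` is Deligne's family package
`deligne1982_weilFamily_globalAction` and `hT` transports algebraicity — from one fibre to all — of
global classes `W ∈ H^{2k}(𝒳(ℂ); ℂ)` along smooth projective families over smooth irreducible bases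
whose fibre restrictions are rational of type `(k,k)` and lie, through a chart `e' : A' ≅ 𝒳_s` of a
`√-p`-abelian `2k`-fold at EVERY fibre, in the strong Weil plane `weilClassesOf A' φ' k p`, then every
rational `(k,k)`-class of the typed Weil plane of every `√-p`-abelian `2k`-fold is algebraic.  Proof:
upgrade the typing (`stub_upgrade`), take the global Weil class of the family through `A`
(`weilFamily_globalWeilClass_of_globalAction`), transport from the tensor fibre `s₀` to `s₁`, return
along `e : A ≅ 𝒳_{s₁}`. [cite: Deligne1982HodgeCycles, proof of Thm. 4.8 (pp. 47–52), Lemma 4.5, Remark 4.10]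
[cite: Grothendieck1966, footnote 13] -/
theorem hodgeWeil_of_weilTransport_of_globalAction (hGA : deligne1982_weilFamily_globalAction)
    {p : ℕ} (hp : p.Prime) (hp4 : p % 4 = 3) (hp7 : 7 ≤ p) {k : ℕ} (hk : 1 ≤ k)
    (hT : ∀ ⦃𝒳 S : SchemeOver ℂ⦄ (f : 𝒳 ⟶ S), IsSmoothProjectiveFamily f (2 * k) →
      IrreducibleSpace S.left → AlgebraicGeometry.Smooth S.hom →
      ∀ (W : complexBetti 𝒳 (2 * k)),
        (∀ s : ComplexPoints S, IsRationalClass (complexBetti.map (fiberι f s) (2 * k) W) ∧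
          IsOfHodgeType (2 * k) (fiberOver f s) (2 * k) k k (complexBetti.map (fiberι f s) (2 * k) W)) →
        (∀ s : ComplexPoints S, ∃ (A' : AbelianVariety ℂ) (φ' : A' ⟶ A') (e' : A'.X ≅ fiberOver f s),
          A'.dim = 2 * k ∧ φ' ≫ φ' = -((p : ℤ) • 𝟙 A') ∧
          complexBetti.map e'.hom (2 * k) (complexBetti.map (fiberι f s) (2 * k) W) ∈
            weilClassesOf A' φ' k p) →
        (∃ s₀ : ComplexPoints S,
          complexBetti.map (fiberι f s₀) (2 * k) W ∈ algebraicClasses (fiberOver f s₀) k) →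
        ∀ s : ComplexPoints S,
          complexBetti.map (fiberι f s) (2 * k) W ∈ algebraicClasses (fiberOver f s) k) :
    ∀ (A : AbelianVariety ℂ) (φ : A ⟶ A), A.dim = 2 * k → φ ≫ φ = -((p : ℤ) • 𝟙 A) →
      ∀ c : complexBetti A.X (2 * k), IsRationalClass c → IsOfHodgeType (2 * k) A.X (2 * k) k k c →
        c ∈ Module.End.eigenspace (complexBetti.map (𝟙 A + φ).hom.hom.hom (2 * k)).hom
              ((1 + Complex.I * (Real.sqrt (p : ℝ) : ℂ)) ^ (2 * k)) ⊔
            Module.End.eigenspace (complexBetti.map (𝟙 A + φ).hom.hom.hom (2 * k)).hom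
              ((1 - Complex.I * (Real.sqrt (p : ℝ) : ℂ)) ^ (2 * k)) →
        c ∈ algebraicClasses A.X k := by
  intro A φ hA hφ c hrat hH hW
  -- the zero class is algebraic
  by_cases h0 : c = 0
  · rw [h0]
    exact Submodule.zero_mem _
  -- typing upgrade: `c` lies in the strong Weil plane of `(A, φ)`
  have hcW := stub_upgrade p hp hp4 hp7 k A φ hA hφ hW
  -- the global Weil class of Deligne's family THROUGH `A`
  obtain ⟨𝒳, S, f, s₁, s₀, e, W, hfam, hirr, hsm, hfibre, hchart, hW₁, halg₀⟩ :=
    weilFamily_globalWeilClass_of_globalAction hGA hp hp4 hp7 hk A φ hA hφ c hcW h0 hrat hH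
  -- transport to the fibre over `s₁`
  have halg₁ : complexBetti.map (fiberι f s₁) (2 * k) W ∈ algebraicClasses (fiberOver f s₁) k :=
    hT f hfam hirr hsm W hfibre hchart ⟨s₀, halg₀⟩ s₁
  -- return along `e : A ≅ 𝒳_{s₁}`
  have key := mem_algebraicClasses_map_of_iso (p := k) (hfam.isSmoothProjective s₁)
    (AbelianVariety.isSmoothProjective_holds (A := A)) e halg₁
  rw [hW₁, ← CategoryTheory.comp_apply, ← complexBetti.map_comp, Iso.hom_inv_id,
    complexBetti.map_id] at key
  exact key

/-! ### Tightness: the rung predicate implies the Weil transport -/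

/-- **`HWA(p, k)` implies the Weil transport `WT(p, k)`** — indeed it makes its conclusion hold at
every fibre outright: read `W|_{𝒳_s}` in the chart `e' : A' ≅ 𝒳_s` (rationality and Hodge type move
along the isomorphism), where it lies in the strong — hence the typed
(`mem_eigenspace_sup_of_mem_weilClassesOf`) — Weil plane of `(A', φ')`, apply `HWA(p, k)` on `A'`, and
return by iso-invariance (`owf_isoTransport`).  Neither the family structure nor the anchor fibre is
used. [cite: vanGeemen1994HodgeAV, 4.9] [cite: Fulton1998, §19.1] -/
theorem weilTransport_of_hodgeWeil {p k : ℕ}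
    (h : ∀ (A : AbelianVariety ℂ) (φ : A ⟶ A), A.dim = 2 * k → φ ≫ φ = -((p : ℤ) • 𝟙 A) →
      ∀ c : complexBetti A.X (2 * k), IsRationalClass c → IsOfHodgeType (2 * k) A.X (2 * k) k k c →
        c ∈ Module.End.eigenspace (complexBetti.map (𝟙 A + φ).hom.hom.hom (2 * k)).hom
              ((1 + Complex.I * (Real.sqrt (p : ℝ) : ℂ)) ^ (2 * k)) ⊔
            Module.End.eigenspace (complexBetti.map (𝟙 A + φ).hom.hom.hom (2 * k)).hom
              ((1 - Complex.I * (Real.sqrt (p : ℝ) : ℂ)) ^ (2 * k)) →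
        c ∈ algebraicClasses A.X k) :
    ∀ ⦃𝒳 S : SchemeOver ℂ⦄ (f : 𝒳 ⟶ S), IsSmoothProjectiveFamily f (2 * k) →
      IrreducibleSpace S.left → AlgebraicGeometry.Smooth S.hom →
      ∀ (W : complexBetti 𝒳 (2 * k)),
        (∀ s : ComplexPoints S, IsRationalClass (complexBetti.map (fiberι f s) (2 * k) W) ∧
          IsOfHodgeType (2 * k) (fiberOver f s) (2 * k) k k (complexBetti.map (fiberι f s) (2 * k) W)) →
        (∀ s : ComplexPoints S, ∃ (A' : AbelianVariety ℂ) (φ' : A' ⟶ A') (e' : A'.X ≅ fiberOver f s),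
          A'.dim = 2 * k ∧ φ' ≫ φ' = -((p : ℤ) • 𝟙 A') ∧
          complexBetti.map e'.hom (2 * k) (complexBetti.map (fiberι f s) (2 * k) W) ∈
            weilClassesOf A' φ' k p) →
        (∃ s₀ : ComplexPoints S,
          complexBetti.map (fiberι f s₀) (2 * k) W ∈ algebraicClasses (fiberOver f s₀) k) →
        ∀ s : ComplexPoints S,
          complexBetti.map (fiberι f s) (2 * k) W ∈ algebraicClasses (fiberOver f s) k := by
  intro 𝒳 S f _hf _hirr _hsm W hfibre hchart _ s
  obtain ⟨A', φ', e', hA', hφ', hmem⟩ := hchart s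
  obtain ⟨hrat, hH⟩ := hfibre s
  have hrat' : IsRationalClass (complexBetti.map e'.hom (2 * k) (complexBetti.map (fiberι f s) (2 * k) W)) :=
    hrat.map _
  have hH' : IsOfHodgeType (2 * k) A'.X (2 * k) k k
      (complexBetti.map e'.hom (2 * k) (complexBetti.map (fiberι f s) (2 * k) W)) :=
    hH.map_of_iso e'
  have halg := h A' φ' hA' hφ' _ hrat' hH' (mem_eigenspace_sup_of_mem_weilClassesOf hmem)
  exact owf_isoTransport _ A' e' k _ halg

/-- **Forgetting the Weil clause**: transport of ALL rational `(k,k)` global classes along families of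
`√-p`-abelian `2k`-folds (the shape of `WeilVariationalHodge` at `M = k`) implies the Weil transport
`WT(p, k)` (the chart gives the `Nonempty (A'.X ≅ 𝒳_s)` clause). [cite: Grothendieck1966, footnote 13] -/
theorem weilTransport_of_transport {p k : ℕ}
    (hT : ∀ ⦃𝒳 S : SchemeOver ℂ⦄ (f : 𝒳 ⟶ S), IsSmoothProjectiveFamily f (2 * k) →
      IrreducibleSpace S.left → AlgebraicGeometry.Smooth S.hom →
      ∀ (W : complexBetti 𝒳 (2 * k)),
        (∀ s : ComplexPoints S, IsRationalClass (complexBetti.map (fiberι f s) (2 * k) W) ∧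
          IsOfHodgeType (2 * k) (fiberOver f s) (2 * k) k k (complexBetti.map (fiberι f s) (2 * k) W)) →
        (∀ s : ComplexPoints S, ∃ (A' : AbelianVariety ℂ) (φ' : A' ⟶ A'),
          A'.dim = 2 * k ∧ φ' ≫ φ' = -((p : ℤ) • 𝟙 A') ∧ Nonempty (A'.X ≅ fiberOver f s)) →
        (∃ s₀ : ComplexPoints S,
          complexBetti.map (fiberι f s₀) (2 * k) W ∈ algebraicClasses (fiberOver f s₀) k) →
        ∀ s : ComplexPoints S,
          complexBetti.map (fiberι f s) (2 * k) W ∈ algebraicClasses (fiberOver f s) k) :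
    ∀ ⦃𝒳 S : SchemeOver ℂ⦄ (f : 𝒳 ⟶ S), IsSmoothProjectiveFamily f (2 * k) →
      IrreducibleSpace S.left → AlgebraicGeometry.Smooth S.hom →
      ∀ (W : complexBetti 𝒳 (2 * k)),
        (∀ s : ComplexPoints S, IsRationalClass (complexBetti.map (fiberι f s) (2 * k) W) ∧
          IsOfHodgeType (2 * k) (fiberOver f s) (2 * k) k k (complexBetti.map (fiberι f s) (2 * k) W)) →
        (∀ s : ComplexPoints S, ∃ (A' : AbelianVariety ℂ) (φ' : A' ⟶ A') (e' : A'.X ≅ fiberOver f s),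
          A'.dim = 2 * k ∧ φ' ≫ φ' = -((p : ℤ) • 𝟙 A') ∧
          complexBetti.map e'.hom (2 * k) (complexBetti.map (fiberι f s) (2 * k) W) ∈
            weilClassesOf A' φ' k p) →
        (∃ s₀ : ComplexPoints S,
          complexBetti.map (fiberι f s₀) (2 * k) W ∈ algebraicClasses (fiberOver f s₀) k) →
        ∀ s : ComplexPoints S,
          complexBetti.map (fiberι f s) (2 * k) W ∈ algebraicClasses (fiberOver f s) k := by
  intro 𝒳 S f hf hirr hsm W hfibre hchart hanchor s
  refine hT f hf hirr hsm W hfibre (fun t ↦ ?_) hanchor s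
  obtain ⟨A', φ', e', hA', hφ', -⟩ := hchart t
  exact ⟨A', φ', hA', hφ', ⟨e'⟩⟩

/-- **GIVEN Deligne's family, the rung predicate `HWA(p, k)` is EQUIVALENT to the Weil transport
`WT(p, k)`** (`p ≡ 3 (4)` prime `≥ 7`, `k ≥ 1`).  [cite: Deligne1982HodgeCycles, proof of Thm. 4.8]
[cite: Grothendieck1966, footnote 13] -/
theorem hodgeWeil_iff_weilTransport_of_globalAction (hGA : deligne1982_weilFamily_globalAction)
    {p : ℕ} (hp : p.Prime) (hp4 : p % 4 = 3) (hp7 : 7 ≤ p) {k : ℕ} (hk : 1 ≤ k) :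
    (∀ (A : AbelianVariety ℂ) (φ : A ⟶ A), A.dim = 2 * k → φ ≫ φ = -((p : ℤ) • 𝟙 A) →
      ∀ c : complexBetti A.X (2 * k), IsRationalClass c → IsOfHodgeType (2 * k) A.X (2 * k) k k c →
        c ∈ Module.End.eigenspace (complexBetti.map (𝟙 A + φ).hom.hom.hom (2 * k)).hom
              ((1 + Complex.I * (Real.sqrt (p : ℝ) : ℂ)) ^ (2 * k)) ⊔
            Module.End.eigenspace (complexBetti.map (𝟙 A + φ).hom.hom.hom (2 * k)).hom
              ((1 - Complex.I * (Real.sqrt (p : ℝ) : ℂ)) ^ (2 * k)) →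
        c ∈ algebraicClasses A.X k) ↔
    (∀ ⦃𝒳 S : SchemeOver ℂ⦄ (f : 𝒳 ⟶ S), IsSmoothProjectiveFamily f (2 * k) →
      IrreducibleSpace S.left → AlgebraicGeometry.Smooth S.hom →
      ∀ (W : complexBetti 𝒳 (2 * k)),
        (∀ s : ComplexPoints S, IsRationalClass (complexBetti.map (fiberι f s) (2 * k) W) ∧
          IsOfHodgeType (2 * k) (fiberOver f s) (2 * k) k k (complexBetti.map (fiberι f s) (2 * k) W)) →
        (∀ s : ComplexPoints S, ∃ (A' : AbelianVariety ℂ) (φ' : A' ⟶ A') (e' : A'.X ≅ fiberOver f s),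
          A'.dim = 2 * k ∧ φ' ≫ φ' = -((p : ℤ) • 𝟙 A') ∧
          complexBetti.map e'.hom (2 * k) (complexBetti.map (fiberι f s) (2 * k) W) ∈
            weilClassesOf A' φ' k p) →
        (∃ s₀ : ComplexPoints S,
          complexBetti.map (fiberι f s₀) (2 * k) W ∈ algebraicClasses (fiberOver f s₀) k) →
        ∀ s : ComplexPoints S,
          complexBetti.map (fiberι f s) (2 * k) W ∈ algebraicClasses (fiberOver f s) k) :=
  ⟨weilTransport_of_hodgeWeil, hodgeWeil_of_weilTransport_of_globalAction hGA hp hp4 hp7 hk⟩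

end Summit.HodgeConjecture.HodgeConjecture.Theorems.HeckePrymWeilLine

end
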